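import Summits.CriticalPhenomena.PercolationContinuityZ3.Theorems.Transplant.SkelFrmBParamsSchedA
import Summits.CriticalPhenomena.PercolationContinuityZ3.Theorems.Transplant.SkelFrmBParamsExcess
import Summits.CriticalPhenomena.PercolationContinuityZ3.Theorems.Transplant.SkelPhiFatRadius
import Summits.CriticalPhenomena.PercolationContinuityZ3.Theorems.Transplant.SkelConcRootRadii
import Summits.CriticalPhenomena.PercolationContinuityZ3.Theorems.Transplant.SkelNegBParamsSlotsSU
import HarnessLib

/-!
# N2 (frames-only node `SamePDropOfSkeletonFrm₁`, OPEN) params column over `PlanarSkeletonFrm` — (ζ″) ledger, part SlotsS: THE FIBRE-BLOCK SLOT VALUE OF RECORD OVER THE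
# STAGGERED CELLS **`NegB.SUS ex mx : NegB.SSlot`** (the q-level `SchedIn` the schedule of record `schedOfS … c (SUS …)` reads) and every schedule-side binder BY NAME

Hand-assembled twin of N1's `SkelNegBParamsSlotsST` (`GSlot`), `…SlotsSU` (`ψπ`, the root radius `Rπ := E₀ − 1` and the four root radii) and `…SlotsSUA` (the (ζ′) block `SUA`,
`mRA`, `fine_diam_le_mRA`) over `PlanarSkeletonFrm` / `DataNS` / the staggered cells: the block is **`SUS := ⟨max fcellsA.rmax (cOffS+1), 1, 0, ψπ, 0, ex …, Rex (mRS …) q⟩`** —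
N1's `SUA` with the column constant `cOffA ↦ cOffS = 2·cOffA` ((r13-19): the column bound at the staggered centre doubles), everything else VERBATIM (`fcellsS.toPCells2 = fcellsA`, so
`rmax` and the fine diameter are `fcellsA`'s); the root radii are read at `schedOfS … c (Sv …)` (any creep value `c`).
* §1 `GSlot`, `ψπ`/`ψπ_eq`, `mRS` (+ `mRS_ge`), `fine_diam_le_mRS`; §2 **`SUS`**, `SUS_fields`, `SUS_rmax_ge`, **`hgap20_US`/`hgapc_US`/`hgapR_US`/`hgapL_US`**, `ex_le_Lp_US`,
  `three_le_E₀_US`, `hsch_US`, `Rex_mono_US`, **`hR₁_US`/`hRex_US`/`hR₁_US_η`**, `E₀_SUS_eq`, `Lp_SUS_eq`;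
* §3 `Rπ` (any block `Sv`), `Rπ_succ` (N1's `twelve_le_E₀` reused), **`hRQ_RS`/`hRB_RS`/`hRQ'_RS`/`hRM_RS`** at `schedOfS`, `le_Rπ_of`, `le_Rπ_of_reachK`; §4 at `SUS`: `ex_le_Rπ`, `fat_le_Rπ`,
  `Rex_fat_le_Rπ_sub`, `SRex_fat_le_Rπ_sub`.
builds on p205010 (kernel theorem, internal audit signed; external expert review pending) — nothing in this file uses p205010; NOTHING is claimed about the open node
`SamePDropOfSkeletonFrm₁` (`SamePDropOfSkeletonNeg₁` is CLOSED in the tree and untouched by this file).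
Lane `prim-bschramm`, seat `prim-bschramm-stmt` (gen 20); helper file (`--supports stmt-CriticalPhenomena-4575 --as helper`); FRM-PARAMS (t9), (r13-19), (r13-20).
[cite: KozmaNitzan2024, §4 Theorem 6 (pp. 25–31): the order of constants; Lemma 12 (p. 24)] [cite: MartineauTassion2017, §4.3]
-/

noncomputable section

open scoped Classical

namespace Summit.CriticalPhenomena.PercolationContinuityZ3.Theorems.Transplant

namespace PlanarSkeletonFrm

namespace NegB

open MeasureTheory Literature.Probability.Percolation Literature.Probability.LatticeModels SimpleGraph
open Literature.Barriers.CriticalPhenomena (graphBall)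
open SkelConc (Consts)
open BoxProdZ2 (ConcRadiiG Erad Frad nQ)
open Skelφ (oriφ trφ)
open Skelφ.StepI (DataN DataNS)
open Skel (excess)
open Neg

/-! ## §1 The residual slot type, the seed's fat radius, the φ-diameter of a rim habitat -/

/-- **A (g,f)-level residual slot**: a floor as a function of everything p-fixed AND the box/width values `(g, f)`. [this work] -/
def GSlot : Type 1 :=
  ∀ (κ : Consts) {V : Type} [DecidableEq V] [Countable V] {G : SimpleGraph V} [G.LocallyFinite], PlanarSkeletonFrm G → V → unitInterval → Skelφ.StepI.DataNS V → ℕ → ℕ → ℕ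

/-- The zero residual. [folklore] -/
def GSlot.zero : GSlot := fun _ _ _ _ _ _ _ _ _ _ _ _ => 0

/-- **The seed's fat radius `ψπ := fatRadius Φ.frame hC D.k`** as a p-level number (`0` off `Φ.CylSubcritical p`). [cite: KozmaNitzan2024, §4 p. 16 (Lemma 9)] -/
def ψπ {V : Type} [Countable V] {G : SimpleGraph V} [G.LocallyFinite] (Φ : PlanarSkeletonFrm G) (p : unitInterval) (D : DataNS V) : ℕ :=
  if h : Φ.CylSubcritical p then Skelφ.fatRadius Φ.frame h D.k else 0

/-- `ψπ = fatRadius Φ.frame hC D.k` under `hC`. [folklore] -/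
theorem ψπ_eq {V : Type} [Countable V] {G : SimpleGraph V} [G.LocallyFinite] (Φ : PlanarSkeletonFrm G) {p : unitInterval} (hC : Φ.CylSubcritical p) (D : DataNS V) :
    ψπ Φ p D = Skelφ.fatRadius Φ.frame hC D.k := by
  unfold ψπ; rw [dif_pos hC]

section Values

variable (κ : Consts) {V : Type} [DecidableEq V] [Countable V] {G : SimpleGraph V} [G.LocallyFinite] (Φ : PlanarSkeletonFrm G) (t : V)
  (p : unitInterval) (D : DataNS V) (g f mx : ℕ)

/-- **The φ-diameter of a rim habitat of the (ζ′) cells** (residual slot `mx`): `mRS := max (2·(n_L + ℓ_L + 3|h_L| + 1)·(50·fcellsA.rmax + 1)) mx`. [this work] -/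
def mRS : ℕ := max (2 * (nL κ Φ t p D g f + ℓL κ Φ t p D g f + 3 * (hL κ Φ t p D g f).natAbs + 1) * (50 * (fcellsA κ Φ t p D g f).rmax + 1)) mx

/-- The two floors inside `mRS`. [folklore] -/
theorem mRS_ge : 2 * (nL κ Φ t p D g f + ℓL κ Φ t p D g f + 3 * (hL κ Φ t p D g f).natAbs + 1) * (50 * (fcellsA κ Φ t p D g f).rmax + 1) ≤ mRS κ Φ t p D g f mx ∧
    mx ≤ mRS κ Φ t p D g f mx := ⟨le_max_left _ _, le_max_right _ _⟩

/-- **FINE DIAMETER ⇒ φ-DIAMETER** for the (ζ′) cells: fine coordinates (map slot `φ′`) within `50·fcellsA.rmax` on both axes give `φ′ d − φ′ d' ∈ box 2 (mRS mx)`. [folklore] -/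
theorem fine_diam_le_mRS (hN : EqNumL κ Φ t p D g f) {φ' : V → Site 2} {d d' : V}
    (h : fineA κ Φ t p D g f φ' d - fineA κ Φ t p D g f φ' d' ∈ box 2 (50 * (fcellsA κ Φ t p D g f).rmax)) : φ' d - φ' d' ∈ box 2 (mRS κ Φ t p D g f mx) := by
  rw [mem_box] at h ⊢
  intro i
  have hρ : ∀ j, |fineA κ Φ t p D g f φ' d j - fineA κ Φ t p D g f φ' d' j| ≤ ((50 * (fcellsA κ Φ t p D g f).rmax : ℕ) : ℤ) := fun j => by
    have hj := h j
    rw [Pi.sub_apply] at hj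
    exact abs_le.2 hj
  have hK := (φ_extent_fineA_at κ Φ t p D g f hN (Nat.cast_nonneg _) hρ i).2
  have hm : ((2 * (nL κ Φ t p D g f + ℓL κ Φ t p D g f + 3 * (hL κ Φ t p D g f).natAbs + 1) * (50 * (fcellsA κ Φ t p D g f).rmax + 1) : ℕ) : ℤ) ≤
      (mRS κ Φ t p D g f mx : ℤ) := by
    exact_mod_cast (mRS_ge κ Φ t p D g f mx).1
  have h2 : 2 * ((nL κ Φ t p D g f : ℤ) + ℓL κ Φ t p D g f + 3 * |hL κ Φ t p D g f| + 1) * (((50 * (fcellsA κ Φ t p D g f).rmax : ℕ) : ℤ) + 1) =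
      ((2 * (nL κ Φ t p D g f + ℓL κ Φ t p D g f + 3 * (hL κ Φ t p D g f).natAbs + 1) * (50 * (fcellsA κ Φ t p D g f).rmax + 1) : ℕ) : ℤ) := by
    push_cast; ring
  rw [Pi.sub_apply]
  exact abs_le.1 (hK.trans (h2 ▸ hm))

end Values

/-! ## §2 The fibre block of record over the staggered cells -/

/-- **THE FIBRE BLOCK OF RECORD OF THE (ζ′) CHAIN**: `⟨max fcellsA.rmax (cOffS+1), 1, 0, ψπ, 0, ex κ Φ t p D g f, NegB.Rex (mRS … (mx …)) q⟩`.
[cite: KozmaNitzan2024, §4 Theorem 6 (pp. 25–31): the order of constants] -/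
def SUS (ex mx : GSlot) : SSlot := fun κ _ _ _ _ _ Φ t p D g f q =>
  ⟨max (fcellsA κ Φ t p D g f).rmax (cOffS κ Φ t p D g f + 1), 1, 0, ψπ Φ p D, 0, ex κ Φ t p D g f, Rex κ Φ (mRS κ Φ t p D g f (mx κ Φ t p D g f)) q⟩

section Facts

variable (κ : Consts) {V : Type} [DecidableEq V] [Countable V] {G : SimpleGraph V} [G.LocallyFinite] (Φ : PlanarSkeletonFrm G) (t : V)
  (p : unitInterval) (D : DataNS V) (g f : ℕ) (ex mx : GSlot) (q : unitInterval)

/-- The fields of `SUS` (all `rfl`). [folklore] -/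
theorem SUS_fields : (SUS ex mx κ Φ t p D g f q).rmax = max (fcellsA κ Φ t p D g f).rmax (cOffS κ Φ t p D g f + 1) ∧ (SUS ex mx κ Φ t p D g f q).u = 1 ∧
    (SUS ex mx κ Φ t p D g f q).M = 0 ∧ (SUS ex mx κ Φ t p D g f q).ψM = ψπ Φ p D ∧ (SUS ex mx κ Φ t p D g f q).ψtop = 0 ∧ (SUS ex mx κ Φ t p D g f q).reachK = ex κ Φ t p D g f ∧
    (SUS ex mx κ Φ t p D g f q).Rex = Rex κ Φ (mRS κ Φ t p D g f (mx κ Φ t p D g f)) q :=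
  ⟨rfl, rfl, rfl, rfl, rfl, rfl, rfl⟩

/-- `fcellsA.rmax ≤ rmax` and `cOffS + 1 ≤ rmax`. [folklore] -/
theorem SUS_rmax_ge : (fcellsA κ Φ t p D g f).rmax ≤ (SUS ex mx κ Φ t p D g f q).rmax ∧ cOffS κ Φ t p D g f + 1 ≤ (SUS ex mx κ Φ t p D g f q).rmax :=
  ⟨le_max_left _ _, le_max_right _ _⟩

/-- **`20·fcellsA.rmax ≤ gap ρ`**. [folklore] -/
theorem hgap20_US (ρ : ℕ) : 20 * (fcellsA κ Φ t p D g f).rmax ≤ Skelφ.Prm.gap (SUS ex mx κ Φ t p D g f q) ρ :=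
  le_trans (Nat.mul_le_mul_left _ (SUS_rmax_ge κ Φ t p D g f ex mx q).1) (Skelφ.Prm.twenty_rmax_le_gap _ ρ)

/-- **`cOffS ≤ gap ρ`**. [folklore] -/
theorem hgapc_US (ρ : ℕ) : cOffS κ Φ t p D g f ≤ Skelφ.Prm.gap (SUS ex mx κ Φ t p D g f q) ρ := by
  have h1 := (SUS_rmax_ge κ Φ t p D g f ex mx q).2
  have h2 := Skelφ.Prm.dG_le_gap (SUS ex mx κ Φ t p D g f q) ρ
  exact le_trans (le_trans (le_trans (Nat.le_succ _) h1) (Nat.le_mul_of_pos_left _ (by norm_num))) h2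

/-- **`cOffS + 2L′ + Rex ρ + 2 ≤ gap ρ`**. [folklore] -/
theorem hgapR_US (ρ : ℕ) : cOffS κ Φ t p D g f + 2 * Skelφ.Prm.Lp (SUS ex mx κ Φ t p D g f q) + Rex κ Φ (mRS κ Φ t p D g f (mx κ Φ t p D g f)) q ρ + 2 ≤
    Skelφ.Prm.gap (SUS ex mx κ Φ t p D g f q) ρ := by
  rw [Skelφ.Prm.gap_eq]
  have h1 : cOffS κ Φ t p D g f + 1 ≤ (SUS ex mx κ Φ t p D g f q).rmax := (SUS_rmax_ge κ Φ t p D g f ex mx q).2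
  have h2 : Rex κ Φ (mRS κ Φ t p D g f (mx κ Φ t p D g f)) q ρ ≤ (SUS ex mx κ Φ t p D g f q).Rex (ρ + 1) := Rex_mono κ Φ _ q (Nat.le_succ ρ)
  generalize (SUS ex mx κ Φ t p D g f q).rmax = R at h1 ⊢
  generalize (SUS ex mx κ Φ t p D g f q).Rex (ρ + 1) = X at h2 ⊢
  generalize Skelφ.Prm.Lp (SUS ex mx κ Φ t p D g f q) = L
  omega

/-- `L′ ≤ gap ρ`. [folklore] -/
theorem hgapL_US (ρ : ℕ) : Skelφ.Prm.Lp (SUS ex mx κ Φ t p D g f q) ≤ Skelφ.Prm.gap (SUS ex mx κ Φ t p D g f q) ρ := Skelφ.Prm.hgapL _ ρ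

/-- **`ex ≤ L′ ≤ E₀`**. [folklore] -/
theorem ex_le_Lp_US : ex κ Φ t p D g f ≤ Skelφ.Prm.Lp (SUS ex mx κ Φ t p D g f q) ∧ Skelφ.Prm.Lp (SUS ex mx κ Φ t p D g f q) ≤ Skelφ.Prm.E₀ (SUS ex mx κ Φ t p D g f q) := by
  refine ⟨?_, Skelφ.Prm.Lp_le_E₀ _⟩
  have h := Skelφ.Prm.reachK_le_Lp (SUS ex mx κ Φ t p D g f q)
  exact h

/-- `3 ≤ E₀`, indeed `45·fcellsA.rmax ≤ E₀`. [folklore] -/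
theorem three_le_E₀_US : 3 ≤ Skelφ.Prm.E₀ (SUS ex mx κ Φ t p D g f q) ∧ 45 * (fcellsA κ Φ t p D g f).rmax ≤ Skelφ.Prm.E₀ (SUS ex mx κ Φ t p D g f q) := by
  have h1 := Skelφ.Prm.planar_le_E₀ (SUS ex mx κ Φ t p D g f q)
  have h2 := (SUS_rmax_ge κ Φ t p D g f ex mx q).1
  have h3 : 1 ≤ (fcellsA κ Φ t p D g f).rmax := le_trans ((fcellsA κ Φ t p D g f).one_le_r 0) ((fcellsA κ Φ t p D g f).r_le_rmax 0)
  have h4 : 45 * (fcellsA κ Φ t p D g f).rmax ≤ Skelφ.Prm.E₀ (SUS ex mx κ Φ t p D g f q) :=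
    le_trans (le_trans (Nat.mul_le_mul_left 45 h2) (Nat.le_add_right _ _)) h1
  exact ⟨le_trans (le_trans (by norm_num : 3 ≤ 45 * 1) (Nat.mul_le_mul_left 45 h3)) h4, h4⟩

/-- **`hsch`**: `Rex (E g' + 1) + L′ ≤ E (g'+1)` for `E := Erad gap 0 E₀`. [folklore] -/
theorem hsch_US (g' : ℕ) : Rex κ Φ (mRS κ Φ t p D g f (mx κ Φ t p D g f)) q (Erad (Skelφ.Prm.gap (SUS ex mx κ Φ t p D g f q)) (fun _ => 0) (Skelφ.Prm.E₀ (SUS ex mx κ Φ t p D g f q)) g' + 1) +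
      Skelφ.Prm.Lp (SUS ex mx κ Φ t p D g f q) ≤ Erad (Skelφ.Prm.gap (SUS ex mx κ Φ t p D g f q)) (fun _ => 0) (Skelφ.Prm.E₀ (SUS ex mx κ Φ t p D g f q)) (g' + 1) := by
  have h := Skelφ.Prm.hsch (SUS ex mx κ Φ t p D g f q) g'
  exact le_trans (Nat.add_le_add_right (Nat.le_add_right _ _) _) h

/-- `Rex` at the value is monotone. [folklore] -/
theorem Rex_mono_US : Monotone (SUS ex mx κ Φ t p D g f q).Rex := Rex_monotone κ Φ _ q

/-- **`hR₁` at the value** (depth `ρ+1`, any centre, either orientation, any `η' ≥ η`, planar diameter `mRS`), consumer's instance. [folklore] -/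
theorem hR₁_US (hC : Φ.CylSubcritical q) (o : Bool) {η' : ℝ} (hη' : Neg.η κ Φ ≤ η') (c : V) :
    ∀ ρ R', (SUS ex mx κ Φ t p D g f q).Rex ρ ≤ R' → ∀ (Rw : ℕ) (D' A' : Finset V), (∀ d ∈ D', d ∈ graphBall G c Rw) →
      (∀ d ∈ D', ∀ d' ∈ D', oriφ Φ.φ o d - oriφ Φ.φ o d' ∈ box 2 (mRS κ Φ t p D g f (mx κ Φ t p D g f))) → A' ⊆ D' → (∀ a ∈ A', a ∈ graphBall G c (ρ + 1)) →
        (bondPercolation G q).real (excess G c R' D' A') ≤ η' := by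
  have hη'' : @Neg.η κ V (fun a b => Classical.propDecidable (a = b)) _ G _ Φ ≤ η' := by convert hη' using 2
  exact hR₁_at κ Φ (mRS κ Φ t p D g f (mx κ Φ t p D g f)) hC o hη'' c

/-- **`hRex` at the value** (depth `R₀'`), consumer's instance. [folklore] -/
theorem hRex_US (hC : Φ.CylSubcritical q) (o : Bool) {η' : ℝ} (hη' : Neg.η κ Φ ≤ η') (c : V) :
    ∀ R₀' R₁, (SUS ex mx κ Φ t p D g f q).Rex R₀' ≤ R₁ → ∀ (Rw : ℕ) (D' A' : Finset V), (∀ d ∈ D', d ∈ graphBall G c Rw) →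
      (∀ d ∈ D', ∀ d' ∈ D', oriφ Φ.φ o d - oriφ Φ.φ o d' ∈ box 2 (mRS κ Φ t p D g f (mx κ Φ t p D g f))) → A' ⊆ D' → (∀ a ∈ A', a ∈ graphBall G c R₀') →
        (bondPercolation G q).real (excess G c R₁ D' A') ≤ η' := by
  have hη'' : @Neg.η κ V (fun a b => Classical.propDecidable (a = b)) _ G _ Φ ≤ η' := by convert hη' using 2
  exact hRex_at κ Φ (mRS κ Φ t p D g f (mx κ Φ t p D g f)) hC o hη'' c

/-- `hR₁` at the value with `η' := η`. [folklore] -/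
theorem hR₁_US_η (hC : Φ.CylSubcritical q) (o : Bool) (c : V) :
    ∀ ρ R', (SUS ex mx κ Φ t p D g f q).Rex ρ ≤ R' → ∀ (Rw : ℕ) (D' A' : Finset V), (∀ d ∈ D', d ∈ graphBall G c Rw) →
      (∀ d ∈ D', ∀ d' ∈ D', oriφ Φ.φ o d - oriφ Φ.φ o d' ∈ box 2 (mRS κ Φ t p D g f (mx κ Φ t p D g f))) → A' ⊆ D' → (∀ a ∈ A', a ∈ graphBall G c (ρ + 1)) →
        (bondPercolation G q).real (excess G c R' D' A') ≤ Neg.η κ Φ :=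
  hR₁_US κ Φ t p D g f ex mx q hC o le_rfl c

/-- **`E₀ (SUS …) = ex + Rex κ Φ mRS q (2·ψπ) + 69·rmax′ + 4·ψπ + 48`** (`rmax′ := max fcellsA.rmax (cOffS+1)`). [folklore] -/
theorem E₀_SUS_eq : Skelφ.Prm.E₀ (SUS ex mx κ Φ t p D g f q) =
    ex κ Φ t p D g f + Rex κ Φ (mRS κ Φ t p D g f (mx κ Φ t p D g f)) q (2 * ψπ Φ p D) + 69 * max (fcellsA κ Φ t p D g f).rmax (cOffS κ Φ t p D g f + 1) + 4 * ψπ Φ p D + 48 := by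
  show Skelφ.Prm.Lp _ + 45 * max (fcellsA κ Φ t p D g f).rmax (cOffS κ Φ t p D g f + 1) + ψπ Φ p D = _
  unfold Skelφ.Prm.Lp Skelφ.Prm.LA Skelφ.Prm.dL
  show 24 * max (fcellsA κ Φ t p D g f).rmax (cOffS κ Φ t p D g f + 1) + 2 * (0 + ψπ Φ p D) + Rex κ Φ (mRS κ Φ t p D g f (mx κ Φ t p D g f)) q (2 * ψπ Φ p D) +
      (24 * 1 + 8 * 0 + 12) + 0 + ψπ Φ p D + 12 * 1 + 2 * 0 + ex κ Φ t p D g f + 45 * max (fcellsA κ Φ t p D g f).rmax (cOffS κ Φ t p D g f + 1) + ψπ Φ p D = _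
  ring

/-- `L′ (SUS …) = ex + Rex(2ψπ) + 24·rmax′ + 3·ψπ + 48`. [folklore] -/
theorem Lp_SUS_eq : Skelφ.Prm.Lp (SUS ex mx κ Φ t p D g f q) =
    ex κ Φ t p D g f + Rex κ Φ (mRS κ Φ t p D g f (mx κ Φ t p D g f)) q (2 * ψπ Φ p D) + 24 * max (fcellsA κ Φ t p D g f).rmax (cOffS κ Φ t p D g f + 1) + 3 * ψπ Φ p D + 48 := by
  unfold Skelφ.Prm.Lp Skelφ.Prm.LA Skelφ.Prm.dL
  show 24 * max (fcellsA κ Φ t p D g f).rmax (cOffS κ Φ t p D g f + 1) + 2 * (0 + ψπ Φ p D) + Rex κ Φ (mRS κ Φ t p D g f (mx κ Φ t p D g f)) q (2 * ψπ Φ p D) +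
      (24 * 1 + 8 * 0 + 12) + 0 + ψπ Φ p D + 12 * 1 + 2 * 0 + ex κ Φ t p D g f = _
  ring

end Facts

/-! ## §3 The root radius `Rπ := E₀ − 1` (any block) and the four root radii at the schedule of record -/

section RootRadii

variable (κ : Consts) {V : Type} [DecidableEq V] [Countable V] {G : SimpleGraph V} [G.LocallyFinite] (Φ : PlanarSkeletonFrm G) (t : V)
  (p : unitInterval) (D : DataNS V) (g f : ℕ) (c : Fin 2 → ℕ) (Sv : SSlot) (q : unitInterval)

/-- **THE ROOT RADIUS OF RECORD** `Rπ := E₀ (Sv … q) − 1` (p3-g9's slot `Rπ` of `rootOblTWAt_negBS_x/_y`; bound under `AtQO O q`, so it may read `q`). [this work] -/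
def Rπ : ℕ := Skelφ.Prm.E₀ (Sv κ Φ t p D g f q) - 1

/-- `Rπ + 1 = E₀`. [folklore] -/
theorem Rπ_succ : Rπ κ Φ t p D g f Sv q + 1 = Skelφ.Prm.E₀ (Sv κ Φ t p D g f q) := by
  have := PlanarSkeletonNeg.NegB.twelve_le_E₀ (Sv κ Φ t p D g f q); unfold Rπ; omega

/-- **`hRQ`**: `Rπ + 1 ≤ rQ 0 0` (`rQ 0 0 = E (nQ 0 0) ⊔ … ≥ E₀`). [folklore] -/
theorem hRQ_RS : Rπ κ Φ t p D g f Sv q + 1 ≤ (schedOfS κ Φ t p D g f c (Sv κ Φ t p D g f q)).rQ 0 0 := by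
  rw [Rπ_succ]
  show _ ≤ max (Erad (Skelφ.Prm.gap (Sv κ Φ t p D g f q)) (fun _ => 0) (Skelφ.Prm.E₀ (Sv κ Φ t p D g f q)) (nQ 0 0)) _
  exact le_trans (Skel.E₀_le_Erad _ _ _ _) (le_max_left _ _)

/-- **`hRB`**: `Rπ + 1 ≤ rB 0 0 du` (`= E (nQ 0 (0+du))`). [folklore] -/
theorem hRB_RS (du : MDir) : Rπ κ Φ t p D g f Sv q + 1 ≤ (schedOfS κ Φ t p D g f c (Sv κ Φ t p D g f q)).rB 0 0 du := by
  rw [Rπ_succ]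
  show _ ≤ Erad (Skelφ.Prm.gap (Sv κ Φ t p D g f q)) (fun _ => 0) (Skelφ.Prm.E₀ (Sv κ Φ t p D g f q)) (nQ 0 (0 + stepVec du))
  exact Skel.E₀_le_Erad _ _ _ _

/-- **`hRQ′`**: `Rπ + 1 ≤ rQ 0 (0 + du)`. [folklore] -/
theorem hRQ'_RS (du : MDir) : Rπ κ Φ t p D g f Sv q + 1 ≤ (schedOfS κ Φ t p D g f c (Sv κ Φ t p D g f q)).rQ 0 ((0 : Site 2) + stepVec du) := by
  rw [Rπ_succ]
  show _ ≤ max (Erad (Skelφ.Prm.gap (Sv κ Φ t p D g f q)) (fun _ => 0) (Skelφ.Prm.E₀ (Sv κ Φ t p D g f q)) (nQ 0 ((0 : Site 2) + stepVec du))) _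
  exact le_trans (Skel.E₀_le_Erad _ _ _ _) (le_max_left _ _)

/-- **`hRM`**: `Rπ + 1 ≤ rM 0 (0 + du)` (`rM 0 (0+du) = F 1 − L′ = E₀ + gap E₀ − L′ ≥ E₀` since `L′ ≤ gap`). [folklore] -/
theorem hRM_RS (du : MDir) : Rπ κ Φ t p D g f Sv q + 1 ≤ (schedOfS κ Φ t p D g f c (Sv κ Φ t p D g f q)).rM 0 ((0 : Site 2) + stepVec du) := by
  rw [Rπ_succ]
  show _ ≤ Frad (Skelφ.Prm.gap (Sv κ Φ t p D g f q)) (fun _ => 0) (Skelφ.Prm.E₀ (Sv κ Φ t p D g f q)) (nQ 0 ((0 : Site 2) + stepVec du)) - Skelφ.Prm.Lp (Sv κ Φ t p D g f q)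
  rw [Skel.nQ_zero_stepVec, BoxProdZ2.Frad_succ, BoxProdZ2.Erad_zero]
  have h := Skelφ.Prm.hgapL (Sv κ Φ t p D g f q) (Skelφ.Prm.E₀ (Sv κ Φ t p D g f q))
  omega

/-- `X + 1 ≤ E₀ → X ≤ Rπ`. [folklore] -/
theorem le_Rπ_of {X : ℕ} (h : X + 1 ≤ Skelφ.Prm.E₀ (Sv κ Φ t p D g f q)) : X ≤ Rπ κ Φ t p D g f Sv q := by
  unfold Rπ; omega

/-- `X + 1 ≤ reachK → X ≤ Rπ` (`reachK ≤ L′ ≤ E₀`). [folklore] -/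
theorem le_Rπ_of_reachK {X : ℕ} (h : X + 1 ≤ (Sv κ Φ t p D g f q).reachK) : X ≤ Rπ κ Φ t p D g f Sv q :=
  le_Rπ_of κ Φ t p D g f Sv q (le_trans h (le_trans (Skelφ.Prm.reachK_le_Lp _) (Skelφ.Prm.Lp_le_E₀ _)))

end RootRadii

/-! ## §4 The `Rπ`-inequalities of the root residue at `SUS`, as floors on `ex` -/

section RootSU

variable (κ : Consts) {V : Type} [DecidableEq V] [Countable V] {G : SimpleGraph V} [G.LocallyFinite] (Φ : PlanarSkeletonFrm G) (t : V)
  (p : unitInterval) (D : DataNS V) (g f : ℕ) (ex mx : GSlot) (q : unitInterval)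

/-- **`X + 1 ≤ ex → X ≤ Rπ`** (p3's `hRlπ hπ1 hπ2 hRb₀ hRr₀ hRbπ`: each a floor on `ex`). [folklore] -/
theorem ex_le_Rπ {X : ℕ} (h : X + 1 ≤ ex κ Φ t p D g f) : X ≤ Rπ κ Φ t p D g f (SUS ex mx) q :=
  le_Rπ_of_reachK κ Φ t p D g f (SUS ex mx) q h

/-- **`hρπ`**: `fatRadius Φ.frame hC D.k ≤ Rπ` (`ψπ + 1 ≤ E₀`). [folklore] -/
theorem fat_le_Rπ (hC : Φ.CylSubcritical p) : Skelφ.fatRadius Φ.frame hC D.k ≤ Rπ κ Φ t p D g f (SUS ex mx) q := by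
  refine le_Rπ_of κ Φ t p D g f (SUS ex mx) q ?_
  rw [← ψπ_eq Φ hC D, E₀_SUS_eq]; omega

/-- **`hR₁b/hR₁r`**: `r₀ + 1 ≤ ex → Rex κ Φ mR q (fatRadius Φ.frame hC D.k) ≤ Rπ − r₀` (`Rex` monotone in the depth, `fatRadius k ≤ 2ψπ`, `Rex(2ψπ) + ex − 1 ≤ E₀ − 1`).
[cite: KozmaNitzan2024, §4 Lemma 12 (p. 24)] -/
theorem Rex_fat_le_Rπ_sub (hC : Φ.CylSubcritical p) {r₀ : ℕ} (h : r₀ + 1 ≤ ex κ Φ t p D g f) :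
    Rex κ Φ (mRS κ Φ t p D g f (mx κ Φ t p D g f)) q (Skelφ.fatRadius Φ.frame hC D.k) ≤ Rπ κ Φ t p D g f (SUS ex mx) q - r₀ := by
  have h1 : Rex κ Φ (mRS κ Φ t p D g f (mx κ Φ t p D g f)) q (Skelφ.fatRadius Φ.frame hC D.k) ≤ Rex κ Φ (mRS κ Φ t p D g f (mx κ Φ t p D g f)) q (2 * ψπ Φ p D) :=
    Rex_mono κ Φ _ q (by rw [ψπ_eq Φ hC D]; omega)
  have h2 := Rπ_succ κ Φ t p D g f (SUS ex mx) q
  rw [E₀_SUS_eq] at h2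
  omega

/-- The same with the schedule's own `Rex` field (`(SUS …).Rex = Rex κ Φ mR q`). [folklore] -/
theorem SRex_fat_le_Rπ_sub (hC : Φ.CylSubcritical p) {r₀ : ℕ} (h : r₀ + 1 ≤ ex κ Φ t p D g f) :
    (SUS ex mx κ Φ t p D g f q).Rex (Skelφ.fatRadius Φ.frame hC D.k) ≤ Rπ κ Φ t p D g f (SUS ex mx) q - r₀ :=
  Rex_fat_le_Rπ_sub κ Φ t p D g f ex mx q hC h

end RootSU

end NegB

end PlanarSkeletonFrm

end Summit.CriticalPhenomena.PercolationContinuityZ3.Theorems.Transplant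

end
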